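/-
Copyright (c) 2026 the pub-hodgecm-mathlib formalisation cell (harness21).  Prover seat hodgecm-mathlib-K2E3-p12 (g4), Track B «K2-LIT» ∕ h413
(`stmt-HodgeConjecture-24833`), line `K2_E3_EllipticInputs`, unit U12-d, §L (LBU-2⁺-D): THE NORM-CLASS SUBGROUP `D = Nm(L_wˣ) ≤ (L⁺_v)ˣ` AND (LBU-2⁺) FROM THE CLASS ORBITAL
INTEGRALS.  2026-09-04.
-/
import Summits.HodgeConjecture.HodgeConjecture.Theorems.K2E3GL2NmNilpotentFourierRegularOfOrbits   -- ★ p857331 (this seat): `(L-B_GL)^D ⟸` class orbital regularity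
import Summits.HodgeConjecture.HodgeConjecture.Theorems.K2E3U2NilpotentFourierRegularOfGL2         -- ★ p857300 (this seat): (LBU-2⁺) letter; CM frame, `exists_quadraticCoordinates`
import Summits.HodgeConjecture.HodgeConjecture.Theorems.K2E3LocalFieldSquaresHensel                -- ★ `isOpen_setOf_isSquare_units`
import Literature.NumberTheory.QuadraticForms.LocalNormIndex                                        -- ★ `quadraticNormSubgroup`, `index_quadraticNormSubgroup_adicCompletion_eq_two` (O'Meara 63:13)
import HarnessLib

/-!
# K2_E3 road (h413), §L — (LBU-2⁺-D): (LBU-2⁺) «(L-B_GL)^{Nm} on `𝔤𝔩₂(L⁺_v)`» ⟸ Fourier regularity of the class orbital integrals for index-two `D`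

Cell `pub/hodgecm-mathlib` (D-0151), Track B, seat K2E3-p12 (g4), §L line lead (road «U-iso-T»).  `--supports stmt-HodgeConjecture-24833 --as helper`; count-neutral plumbing.

* §1 (local field `F`) `isOpen_of_sq_mem` — a subgroup of `Fˣ` containing the squares is open (★ `isOpen_setOf_isSquare_units`, `2 ≠ 0`); `exists_reps_of_index_two` — for
  `[Fˣ : D] = 2` with squares in `D`, representatives `![1, a₁]` meeting every class once.
* §2 (quadratic frame `E = ι F ⊕ λ ι F`) `mem_quadraticNormSubgroup_iff_exists_norm` — `u ∈ quadraticNormSubgroup F d` (`u = x² − d y²`) **iff** `ι u · e·σe = 1` for some `e ∈ E`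
  (`λ² = ι d`): the norm group of ★ `QuadraticNormIndex` IS the `G⁺`-class group of ★ p857199∕p857300; `not_isSquare_of_skew_sq` — `d` is not a square in `F`.
* §3 (CM) **`gl2Nm_nilpotentFourierRegular_of_orbits`** — THE HEAD: the (LBU-2⁺) letter of ★ p857300 (`hGL`) from `hB` = «for every open index-two `D ≤ (L⁺_v)ˣ` with squares,
  every Haar data and every class `a`, the class orbital integral `∫_{chart⁻¹𝒪_a} 𝓕_{ψ∘ι}f` is a regular function» — ★ p857331 at `D = quadraticNormSubgroup (L⁺_v) d` (index two:
  ★ `index_quadraticNormSubgroup_adicCompletion_eq_two`, O'Meara 63:13), `κ = haar`, `dx = addHaar`.  With ★ p857300: **(L-B_U)′ :373 at `N = 2`, every `H`, ⟸ `hB`**.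

HONEST LABEL: HC_CM is proved only modulo the 7 printed citations (2 remaining named inputs: hLiu418 = stmt-HodgeConjecture-24832, h413 = stmt-HodgeConjecture-24833)
until rung 0 closes; count-neutral plumbing; `hB` (the two class orbital integrals, K2E5-p17 (g3) line side ∕ K2E5-p10 (g4) K-side) is NOT ★.

References: [HarishChandra1999AdmissibleDistributions] Harish-Chandra (DeBacker–Sally) (1999), Thm. 4.4 p. 11, Lemma 5.2; [Omeara1963] O'Meara, *Introduction to Quadratic
Forms* (1963), §63B 63:13; [PlatonovRapinchuk1994] §2.3; [Serre1979] Serre, *Local Fields*, XIV §3.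
-/

set_option autoImplicit false
set_option linter.dupNamespace false   -- `Summit.HodgeConjecture.HodgeConjecture.…` (D-0017 nested layout; lakefile exemption for Summits)

noncomputable section

open MeasureTheory Measure Filter Topology NumberField IsDedekindDomain
open scoped Matrix MatrixGroups NNReal
open Literature.NumberTheory.Rogawski1990 Literature.NumberTheory.Automorphic Literature.NumberTheory.Automorphic.UnitaryGroup Literature.NumberTheory.Automorphic.LocalFieldHaar
open Literature.NumberTheory.GaloisRepresentations Literature.NumberTheory.GaloisRepresentations.IsNonarchimedeanLocalField
open Literature.NumberTheory.QuadraticForms (quadraticNormSubgroup mem_quadraticNormSubgroup_iff mem_quadraticNormSubgroup_of_isSquare)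
open Summit.HodgeConjecture.HodgeConjecture.Cruxes.H413.K2E3LieUnitary
open Summit.HodgeConjecture.HodgeConjecture.Cruxes.H413.K2E3U2DiscrInvFourthRootLocallyIntegrable (exists_quadraticCoordinates)
open Summit.HodgeConjecture.HodgeConjecture.Cruxes.H413.K2E3GL2NmNilpotentFourierRegularOfOrbits (detSubgroup_nilpotentFourierRegular_of_orbits)

namespace Summit.HodgeConjecture.HodgeConjecture.Cruxes.H413.K2E3U2NilpotentFourierRegularOfGL2NmOrbits

/-! ## §1  Subgroups of `Fˣ` containing the squares -/

section Local

variable {F : Type*} [Field F] [ValuativeRel F] [TopologicalSpace F] [IsNonarchimedeanLocalField F]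

/-- A subgroup of `Fˣ` containing all squares is open (`2 ≠ 0`): the squares form an open neighbourhood of `1` (★ `isOpen_setOf_isSquare_units`). [cite: Serre1979, XIV §3] -/
theorem isOpen_of_sq_mem (h2 : (2 : F) ≠ 0) (D : Subgroup Fˣ) (hD2 : ∀ u : Fˣ, u * u ∈ D) : IsOpen (D : Set Fˣ) := by
  refine Subgroup.isOpen_of_mem_nhds D (g := 1) ?_
  refine Filter.mem_of_superset ((K2E3LocalFieldSquaresHensel.isOpen_setOf_isSquare_units h2).mem_nhds ⟨1, (mul_one 1).symm⟩) ?_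
  rintro u ⟨r, hr⟩
  rw [hr]
  exact hD2 r

omit [ValuativeRel F] [TopologicalSpace F] [IsNonarchimedeanLocalField F] in
/-- Representatives `![1, a₁]` of `Fˣ ∕ D` for `[Fˣ : D] = 2`, `D ⊇ (Fˣ)²`: every class is met, and the two classes are distinct. [cite: Omeara1963, §63B 63:13] -/
theorem exists_reps_of_index_two (D : Subgroup Fˣ) (hD2 : ∀ u : Fˣ, u * u ∈ D) (hidx : D.index = 2) :
    ∃ a : Fin 2 → Fˣ, (∀ u : Fˣ, ∃ i, (a i)⁻¹ * u ∈ D) ∧ (∀ i j, i ≠ j → (a i)⁻¹ * a j ∉ D) := by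
  obtain ⟨a₁, ha₁⟩ := Subgroup.index_eq_two_iff.1 hidx
  have ha₁D : a₁ ∉ D := fun h => by
    have := ha₁ 1
    rw [one_mul] at this
    rcases this with ⟨-, h1⟩ | ⟨-, h1⟩
    · exact h1 D.one_mem
    · exact h1 h
  refine ⟨![1, a₁], fun u => ?_, fun i j hij => ?_⟩
  · by_cases hu : u ∈ D
    · exact ⟨0, by simpa using hu⟩
    · refine ⟨1, ?_⟩
      have hua : u * a₁ ∈ D := ((ha₁ u).resolve_right (fun h => hu h.1)).1
      have : a₁⁻¹ * u = (u * a₁) * (a₁⁻¹ * a₁⁻¹) := by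
        rw [mul_assoc, ← mul_assoc a₁, mul_inv_cancel, one_mul]
        exact mul_comm _ _
      simp only [Matrix.cons_val_one, Matrix.cons_val_fin_one]
      rw [this]
      exact D.mul_mem hua (hD2 _)
  · fin_cases i <;> fin_cases j
    · exact absurd rfl hij
    · simpa using ha₁D
    · simpa using fun h => ha₁D (by simpa using D.inv_mem h)
    · exact absurd rfl hij

end Local

/-! ## §2  The norm group of `E = ι F ⊕ λ ι F` is `quadraticNormSubgroup F d`, `λ² = ι d` -/

section Quadratic

variable {F E : Type*} [Field F] [Field E] (σ : E →+* E) (ι : F →+* E) (lam : E) (ρ : E → F × F)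
  (hρ1 : ∀ z, ι (ρ z).1 + lam * ι (ρ z).2 = z) (hσι : ∀ r, σ (ι r) = ι r) (hσl : σ lam = -lam) (d : F) (hd : lam * lam = ι d)

include hρ1 hσι hσl hd in
/-- **`Nm(Eˣ) = quadraticNormSubgroup F d`** in the currency of ★ p857199: `u = x² − d·y²` for some `x y ∈ F` iff `ι(u) · e·σ(e) = 1` for some `e ∈ E` (`e = (ι x + λ ι y)⁻¹`;
conversely read `e⁻¹` in the coordinates `ρ`). [cite: Omeara1963, §63B] [cite: PlatonovRapinchuk1994, §2.3] -/
theorem mem_quadraticNormSubgroup_iff_exists_norm (u : Fˣ) : u ∈ quadraticNormSubgroup F d ↔ ∃ e : E, ι (u : F) * (e * σ e) = 1 := by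
  have hnorm : ∀ x y : F, (ι x + lam * ι y) * σ (ι x + lam * ι y) = ι (x ^ 2 - d * y ^ 2) := fun x y => by
    rw [map_add, map_mul, hσι, hσι, hσl, map_sub, map_pow, map_mul, map_pow, ← hd]; ring
  constructor
  · rintro ⟨x, y, hxy⟩
    have hu0 : ι (u : F) ≠ 0 := (map_ne_zero ι).2 u.ne_zero
    have he0 : ι x + lam * ι y ≠ 0 := fun h => by
      have := hnorm x y
      rw [h, zero_mul, hxy] at this
      exact hu0 this.symm
    refine ⟨(ι x + lam * ι y)⁻¹, ?_⟩
    rw [map_inv₀, ← mul_inv, hnorm, hxy, mul_inv_cancel₀ hu0]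
  · rintro ⟨e, he⟩
    have he0 : e ≠ 0 := fun h => by rw [h, zero_mul, mul_zero] at he; exact zero_ne_one he
    -- `ι u = (e σ e)⁻¹ = e⁻¹ σ(e⁻¹) = ι(x² − d y²)` with `(x, y) = ρ(e⁻¹)`
    have hcoord := hρ1 e⁻¹
    have key : ι (u : F) = ι ((ρ e⁻¹).1 ^ 2 - d * (ρ e⁻¹).2 ^ 2) := by
      rw [← hnorm, hcoord, map_inv₀, ← mul_inv]
      exact eq_inv_of_mul_eq_one_left he
    exact ⟨(ρ e⁻¹).1, (ρ e⁻¹).2, (ι.injective key).symm⟩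

include hσl hd in
/-- `d` is not a square in `F` (`λ² = ι d`, `σλ = −λ ≠ λ`). [cite: PlatonovRapinchuk1994, §2.3] -/
theorem not_isSquare_of_skew_sq (hσι : ∀ r, σ (ι r) = ι r) (h2 : (2 : E) ≠ 0) (hl0 : lam ≠ 0) : ¬ IsSquare d := by
  rintro ⟨s, hs⟩
  have h1 : (lam - ι s) * (lam + ι s) = 0 := by
    have : lam * lam = ι s * ι s := by rw [hd, hs, map_mul]
    linear_combination this
  rcases mul_eq_zero.1 h1 with h | h
  · have hl : lam = ι s := sub_eq_zero.1 h
    have := hσl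
    rw [hl, hσι] at this
    -- `ι s = -ι s` forces `ι s = 0`, i.e. `lam = 0`
    have h0 : (2 : E) * ι s = 0 := by linear_combination this
    exact hl0 (by rw [hl]; exact (mul_eq_zero.1 h0).resolve_left h2)
  · have hl : lam = -ι s := eq_neg_of_add_eq_zero_left h
    have := hσl
    rw [hl, map_neg, hσι, neg_neg] at this
    have h0 : (2 : E) * ι s = 0 := by linear_combination -this
    exact hl0 (by rw [hl, (mul_eq_zero.1 h0).resolve_left h2, neg_zero])

end Quadratic

/-! ## §3  (LBU-2⁺) from the class orbital integrals at the CM place -/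

section CM

variable (L : Type) [Field L] [NumberField L] [IsCMField L] (v : HeightOneSpectrum (𝓞 ↥(maximalRealSubfield L)))
  (w : UnitaryGroup.PlacesOver L v) (hw : IsCMField.complexConj L • w.1 = w.1)

/-- **(LBU-2⁺) «(L-B_GL)^{Nm} ON `𝔤𝔩₂(L⁺_v)`» (the letter `hGL` of ★ p857300, VERBATIM) ⟸ the Fourier regularity of the class orbital integrals for every open index-two
`D ≤ (L⁺_v)ˣ` containing the squares** (`hB`, one regular function per class `a`; ★ p857331 at `D = Nm(L_wˣ) = quadraticNormSubgroup (L⁺_v) d`, O'Meara 63:13 for the index,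
`κ = haar(GL₂(𝒪))`, `dx = addHaar`).  Hence, with ★ p857300, (L-B_U)′ :373 at `N = 2` for every `H` reduces to `hB`.
[cite: HarishChandra1999AdmissibleDistributions, Thm. 4.4 p. 11, Lemma 5.2] [cite: Omeara1963, §63B 63:13] [cite: PlatonovRapinchuk1994, §2.3] -/
theorem gl2Nm_nilpotentFourierRegular_of_orbits (ψ : AddChar (w.1.adicCompletion L) Circle) (hψ : ψ.IsContinuousNontrivial)
    (hψι : ∃ a : w.1.adicCompletion L, galAdicCompletionMap (L := L) (IsCMField.complexConj L) hw a = a ∧ ψ a ≠ 1)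
    (hB : ∀ (D : Subgroup (v.adicCompletion ↥(maximalRealSubfield L))ˣ), IsOpen (D : Set (v.adicCompletion ↥(maximalRealSubfield L))ˣ) → (∀ u : (v.adicCompletion ↥(maximalRealSubfield L))ˣ, u * u ∈ D) → D.index = 2 →
      ∀ [MeasurableSpace (v.adicCompletion ↥(maximalRealSubfield L))] [BorelSpace (v.adicCompletion ↥(maximalRealSubfield L))] [MeasurableSpace (GL (Fin 2) (v.adicCompletion ↥(maximalRealSubfield L)))] [BorelSpace (GL (Fin 2) (v.adicCompletion ↥(maximalRealSubfield L)))]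
        (κ : Measure ↥(glInt 2 (v.adicCompletion ↥(maximalRealSubfield L)))) [IsHaarMeasure κ] (dx : Measure (v.adicCompletion ↥(maximalRealSubfield L))) [dx.IsAddHaarMeasure]
        [MeasurableSpace (Matrix (Fin 2) (Fin 2) (v.adicCompletion ↥(maximalRealSubfield L)))] [BorelSpace (Matrix (Fin 2) (Fin 2) (v.adicCompletion ↥(maximalRealSubfield L)))] (μ' : Measure (Matrix (Fin 2) (Fin 2) (v.adicCompletion ↥(maximalRealSubfield L)))) [μ'.IsAddHaarMeasure] (a : (v.adicCompletion ↥(maximalRealSubfield L))ˣ),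
      ∃ Fr : (Matrix (Fin 2) (Fin 2) (v.adicCompletion ↥(maximalRealSubfield L))) → ℂ, LocallyIntegrable Fr μ' ∧
        (∀ f : (Matrix (Fin 2) (Fin 2) (v.adicCompletion ↥(maximalRealSubfield L))) → ℂ, IsLocSmooth f →
          ∫ p in {p : ↥(glInt 2 (v.adicCompletion ↥(maximalRealSubfield L))) × (v.adicCompletion ↥(maximalRealSubfield L)) | (((p.1 : GL (Fin 2) (v.adicCompletion ↥(maximalRealSubfield L))) : Matrix (Fin 2) (Fin 2) (v.adicCompletion ↥(maximalRealSubfield L))) * !![0, p.2; 0, 0] * ((((p.1 : GL (Fin 2) (v.adicCompletion ↥(maximalRealSubfield L))))⁻¹ : GL (Fin 2) (v.adicCompletion ↥(maximalRealSubfield L))) : Matrix (Fin 2) (Fin 2) (v.adicCompletion ↥(maximalRealSubfield L)))) ∈ MulAction.orbit ↥((D.comap (Matrix.GeneralLinearGroup.det : GL (Fin 2) (v.adicCompletion ↥(maximalRealSubfield L)) →* (v.adicCompletion ↥(maximalRealSubfield L))ˣ)).comap (ConjAct.ofConjAct : ConjAct (GL (Fin 2) (v.adicCompletion ↥(maximalRealSubfield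 L))) ≃* GL (Fin 2) (v.adicCompletion ↥(maximalRealSubfield L))).toMonoidHom) (!![0, (a : v.adicCompletion ↥(maximalRealSubfield L)); 0, 0] : Matrix (Fin 2) (Fin 2) (v.adicCompletion ↥(maximalRealSubfield L)))}, (fun Y : Matrix (Fin 2) (Fin 2) (v.adicCompletion ↥(maximalRealSubfield L)) => ∫ X, ((ψ (toPlace v w (Matrix.trace (Y * X))) : Circle) : ℂ) * f X ∂μ') (((p.1 : GL (Fin 2) (v.adicCompletion ↥(maximalRealSubfield L))) : Matrix (Fin 2) (Fin 2) (v.adicCompletion ↥(maximalRealSubfield L))) * !![0, p.2; 0, 0] * ((((p.1 : GL (Fin 2) (v.adicCompletion ↥(maximalRealSubfield L))))⁻¹ : GL (Fin 2) (v.adicCompletion ↥(maximalRealSubfield L))) : Matrix (Fin 2) (Fin 2) (v.adicCompletion ↥(maximalRealSubfield L)))) ∂(κ.prod dx) = ∫ X, f X * Fr X ∂μ') ∧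
        (∀ X : Matrix (Fin 2) (Fin 2) (v.adicCompletion ↥(maximalRealSubfield L)), IsUnit X.charpoly.discr → ∀ᶠ Y in 𝓝 X, Fr Y = Fr X) ∧
        (∀ C : Set (Matrix (Fin 2) (Fin 2) (v.adicCompletion ↥(maximalRealSubfield L))), IsCompact C → ∃ B : ℝ, ∀ X ∈ C, ((NNReal.sqrt (normAbs (v.adicCompletion ↥(maximalRealSubfield L)) X.charpoly.discr) : ℝ≥0) : ℝ) * ‖Fr X‖ ≤ B)) :
    ∀ [MeasurableSpace (Matrix (Fin 2) (Fin 2) (v.adicCompletion ↥(maximalRealSubfield L)))] [BorelSpace (Matrix (Fin 2) (Fin 2) (v.adicCompletion ↥(maximalRealSubfield L)))] (μ' : Measure (Matrix (Fin 2) (Fin 2) (v.adicCompletion ↥(maximalRealSubfield L)))) [μ'.IsAddHaarMeasure]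
      (T' : ((Matrix (Fin 2) (Fin 2) (v.adicCompletion ↥(maximalRealSubfield L))) → ℂ) → ℂ),
      (∀ f₁ f₂ : (Matrix (Fin 2) (Fin 2) (v.adicCompletion ↥(maximalRealSubfield L))) → ℂ, IsLocSmooth f₁ → IsLocSmooth f₂ → T' (f₁ + f₂) = T' f₁ + T' f₂) →
      (∀ (a : ℂ) (f : (Matrix (Fin 2) (Fin 2) (v.adicCompletion ↥(maximalRealSubfield L))) → ℂ), IsLocSmooth f → T' (a • f) = a * T' f) →
      (∀ g : GL (Fin 2) (v.adicCompletion ↥(maximalRealSubfield L)), (∃ e : w.1.adicCompletion L, toPlace v w ((g : Matrix (Fin 2) (Fin 2) (v.adicCompletion ↥(maximalRealSubfield L))).det) * (e * galAdicCompletionMap (L := L) (IsCMField.complexConj L) hw e) = 1) →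
        ∀ f : (Matrix (Fin 2) (Fin 2) (v.adicCompletion ↥(maximalRealSubfield L))) → ℂ, IsLocSmooth f → T' (fun X => f ((g : Matrix (Fin 2) (Fin 2) (v.adicCompletion ↥(maximalRealSubfield L))) * X * ((g⁻¹ : GL (Fin 2) (v.adicCompletion ↥(maximalRealSubfield L))) : Matrix (Fin 2) (Fin 2) (v.adicCompletion ↥(maximalRealSubfield L))))) = T' f) →
      (∀ f : (Matrix (Fin 2) (Fin 2) (v.adicCompletion ↥(maximalRealSubfield L))) → ℂ, IsLocSmooth f → (∀ X ∈ tsupport f, ¬ IsNilpotent X) → T' f = 0) →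
      ∃ Fn' : (Matrix (Fin 2) (Fin 2) (v.adicCompletion ↥(maximalRealSubfield L))) → ℂ, LocallyIntegrable Fn' μ' ∧
        (∀ f : (Matrix (Fin 2) (Fin 2) (v.adicCompletion ↥(maximalRealSubfield L))) → ℂ, IsLocSmooth f →
          T' (fun Y => ∫ X, ((ψ (toPlace v w (Matrix.trace (Y * X))) : Circle) : ℂ) * f X ∂μ') = ∫ X, f X * Fn' X ∂μ') ∧
        (∀ X : Matrix (Fin 2) (Fin 2) (v.adicCompletion ↥(maximalRealSubfield L)), IsUnit X.charpoly.discr → ∀ᶠ Y in 𝓝 X, Fn' Y = Fn' X) ∧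
        (∀ C : Set (Matrix (Fin 2) (Fin 2) (v.adicCompletion ↥(maximalRealSubfield L))), IsCompact C → ∃ B : ℝ, ∀ X ∈ C, ((NNReal.sqrt (normAbs (v.adicCompletion ↥(maximalRealSubfield L)) X.charpoly.discr) : ℝ≥0) : ℝ) * ‖Fn' X‖ ≤ B) := by
  intro _ _ μ' _ T' hT1 hT2 hT3 hT4
  classical
  -- the quadratic frame
  haveI : Algebra.IsQuadraticExtension ↥(maximalRealSubfield L) L := IsCMField.isQuadraticExtension L
  have hc1 := IsCMField.complexConj_ne_one L
  have hσι : ∀ r, galAdicCompletionMap (L := L) (IsCMField.complexConj L) hw (toPlace v w r) = toPlace v w r := fun r =>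
    (galAdicCompletionMap_eq_self_iff_mem_range (IsCMField.complexConj L) hc1 v w hw _).2 ⟨r, rfl⟩
  have hιr : ∀ y : w.1.adicCompletion L, galAdicCompletionMap (L := L) (IsCMField.complexConj L) hw y = y ↔ y ∈ Set.range (toPlace v w) :=
    fun y => galAdicCompletionMap_eq_self_iff_mem_range (IsCMField.complexConj L) hc1 v w hw y
  have h2 : (2 : w.1.adicCompletion L) ≠ 0 := two_ne_zero
  have h2F : (2 : v.adicCompletion ↥(maximalRealSubfield L)) ≠ 0 := two_ne_zero
  obtain ⟨lam, d, ρ, hσl, hd, hd0, -, hρ1, -⟩ := exists_quadraticCoordinates L v w hw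
  have hl0 : lam ≠ 0 := fun h => by
    rw [h, mul_zero] at hd
    exact hd0 ((map_eq_zero (toPlace v w)).1 hd.symm)
  -- `D = Nm(L_wˣ)`
  obtain ⟨D, hDdef⟩ : ∃ D : Subgroup (v.adicCompletion ↥(maximalRealSubfield L))ˣ, D = quadraticNormSubgroup (v.adicCompletion ↥(maximalRealSubfield L)) d := ⟨_, rfl⟩
  have hDmem : ∀ u : (v.adicCompletion ↥(maximalRealSubfield L))ˣ, u ∈ D ↔ ∃ e : w.1.adicCompletion L, toPlace v w (u : v.adicCompletion ↥(maximalRealSubfield L)) * (e * galAdicCompletionMap (L := L) (IsCMField.complexConj L) hw e) = 1 :=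
    fun u => by
      rw [hDdef]
      exact mem_quadraticNormSubgroup_iff_exists_norm (galAdicCompletionMap (L := L) (IsCMField.complexConj L) hw) (toPlace v w) lam ρ hρ1 hσι hσl d hd u
  have hD2 : ∀ u : (v.adicCompletion ↥(maximalRealSubfield L))ˣ, u * u ∈ D := fun u => by
    rw [hDdef]
    exact mem_quadraticNormSubgroup_of_isSquare d ⟨u, by rw [Units.val_mul]⟩
  have hDo : IsOpen (D : Set (v.adicCompletion ↥(maximalRealSubfield L))ˣ) := isOpen_of_sq_mem h2F D hD2
  have hidx : D.index = 2 := by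
    rw [hDdef]
    exact Literature.NumberTheory.QuadraticForms.index_quadraticNormSubgroup_adicCompletion_eq_two (maximalRealSubfield L) v hd0
      (not_isSquare_of_skew_sq (galAdicCompletionMap (L := L) (IsCMField.complexConj L) hw) (toPlace v w) lam hσl d hd hσι h2 hl0)
  obtain ⟨a, hcov, hdis⟩ := exists_reps_of_index_two D hD2 hidx
  -- Haar data on `GL₂(𝒪) × L⁺_v`
  letI : MeasurableSpace (v.adicCompletion ↥(maximalRealSubfield L)) := borel _
  haveI : BorelSpace (v.adicCompletion ↥(maximalRealSubfield L)) := ⟨rfl⟩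
  letI : MeasurableSpace (GL (Fin 2) (v.adicCompletion ↥(maximalRealSubfield L))) := borel _
  haveI : BorelSpace (GL (Fin 2) (v.adicCompletion ↥(maximalRealSubfield L))) := ⟨rfl⟩
  haveI : CompactSpace ↥(glInt 2 (v.adicCompletion ↥(maximalRealSubfield L))) := isCompact_iff_compactSpace.1 (isCompact_glInt 2 (v.adicCompletion ↥(maximalRealSubfield L)))
  haveI : BorelSpace ↥(glInt 2 (v.adicCompletion ↥(maximalRealSubfield L))) := Subtype.borelSpace _
  -- the character `ψ ∘ ι`
  let ψF : AddChar (v.adicCompletion ↥(maximalRealSubfield L)) Circle := ψ.compAddMonoidHom (toPlace v w).toAddMonoidHom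
  have hψF_apply : ∀ t, ψF t = ψ (toPlace v w t) := fun t => rfl
  have hψF : ψF.IsContinuousNontrivial := by
    refine ⟨hψ.1.comp (continuous_toPlace v w), fun h0 => ?_⟩
    obtain ⟨a', ha', hψa⟩ := hψι
    obtain ⟨r, rfl⟩ := (hιr a').1 ha'
    have : ψF r = 1 := by rw [h0]; rfl
    exact hψa (by rw [← hψF_apply]; exact this)
  -- ★ p857331 at `D`, `κ = haar`, `dx = addHaar` (read in the currency `ψ ∘ ι`)
  have key := detSubgroup_nilpotentFourierRegular_of_orbits D ψF μ' (Measure.haar : Measure ↥(glInt 2 (v.adicCompletion ↥(maximalRealSubfield L)))) (Measure.addHaar : Measure (v.adicCompletion ↥(maximalRealSubfield L)))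
    hψF hDo hD2 a hcov hdis
  simp only [hψF_apply] at key
  exact key (fun i => hB D hDo hD2 hidx (Measure.haar : Measure ↥(glInt 2 (v.adicCompletion ↥(maximalRealSubfield L)))) (Measure.addHaar : Measure (v.adicCompletion ↥(maximalRealSubfield L))) μ' (a i))
    T' hT1 hT2 (fun g hg f hf => hT3 g (by
      obtain ⟨e, he⟩ := (hDmem _).1 hg
      exact ⟨e, by rwa [Matrix.GeneralLinearGroup.val_det_apply] at he⟩) f hf) hT4

end CM

end Summit.HodgeConjecture.HodgeConjecture.Cruxes.H413.K2E3U2NilpotentFourierRegularOfGL2NmOrbits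

end
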